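import Mathlib
import HarnessLib
import Summits.NavierStokesRegularity.NavierStokesRegularity.Theorems.IsobarTomographyIsobaricLinesLiouvilleHullReductionSix

/-!
# Line `Ideator2Sketch` (card `flux-surface-persistence`) — skeleton v8 for crux `IsobaricLinesLiouville`
(stmt-NavierStokesRegularity-11741; continuation lead prover-line-stmt-NavierStokesRegularity-11741-c2-0)

State at v8 (2026-08-17, cycle 1 of lead c2 continued). v8 = v7 with hull (B) widened to the SHEAR
hull (B′) `v(t, x + δa) − v(t, x) ∈ ℝa` (leaf `stub_shearTranslationLeaf` p152450, assembly
`isobaricLinesLiouville_of_hull5s` in `…HullReductionSix`), the global form of the conjectured local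
normal form of the swirling axisymmetric isobaric class (crux dir `AxiRigidity-c2.md` REV 4–6).
EVERYTHING but the bet is landed and imported through `…HullReductionSix` ⊇ `…HullReductionFive` (which imports `…HullReduction`, the identity layer, covariance, the
symmetric Liouville leaves (A)–(C), the screw leaf (D) `stub_screwLeaf` p126193, the engine
`stub_divFormLiouville` p126073 and its Navier–Stokes data `stub_noStretchData` p126406, and proves
`sliceConst_of_twoStretchFree` (hull (E)) and `isobaricLinesLiouville_of_hull5` /
`hull5_of_isobaricLinesLiouville`: the five-hull form of the bet is EQUIVALENT to the crux).
One registered stub remains: `stub_hullRigidity` (v8 signature, five hulls with the shear hull). The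
composition is the landed `isobaricLinesLiouville_of_hull5s` applied to it.
-/

noncomputable section

-- the summit and its single problem share the name (D-0017 nested layout)
set_option linter.dupNamespace false

namespace Summit.NavierStokesRegularity.NavierStokesRegularity.Cruxes.IsobaricLinesLiouville.Lines.Ideator2Sketch

open scoped InnerProductSpace RealInnerProductSpace Topology ContDiff Laplacian Matrix
open Literature.Analysis.FluidPDE Set Filter MeasureTheory Function WithLp
open Summit.NavierStokesRegularity.NavierStokesRegularity.Theses.IsobarTomography
open Summit.NavierStokesRegularity.NavierStokesRegularity.Theorems.IsobaricLinesLiouville.FluxSurfacePersistence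

/-! ## Stub — the bet (v8 signature: five hulls, shear hull (B′)) -/

/-- **HULL RIGIDITY** (the bet of the line; intrinsic form, v6): an isobaric bounded ancient mild
solution (classical on `(-∞,0)`, `ω·∇q ≡ 0`) which satisfies the persistence identity, the twist
identity and the Newcomb integrals on closed vortex lines lies, at all `t < 0` simultaneously, in
one of five hulls: (A) vorticity along one fixed vector `a` (`a = 0`: irrotational); (B′) velocity
changing along one fixed direction `a ≠ 0` only by multiples of `a` (shear hull ⊋ 2½-dimensional); (C)
infinitesimally axisymmetric without swirl about one fixed axis; (D) vorticity along one fixed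
screw field `x ↦ a × (x − c) + b`, `⟪a,b⟫ ≠ 0`, without screw swirl; (E) two fixed directions
`e₁, e₂` with `e₁ × e₂ ≠ 0` whose velocity components are constant along vortex lines. Implied by
the crux (constant slices satisfy (A)); implies it (`IsobaricLinesLiouville_of`). (v8: intrinsic form v6
with (B) ↦ (B′).) -/
theorem stub_hullRigidity :
    ∀ (v : ℝ → (EuclideanSpace ℝ (Fin 3)) → (EuclideanSpace ℝ (Fin 3)))
      (q : ℝ → (EuclideanSpace ℝ (Fin 3)) → ℝ),
      IsBoundedAncientMildSolution 1 v → IsClassicalNSSolutionOn (Set.Iio 0) 1 0 v q →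
      (∀ t < 0, ∀ x : EuclideanSpace ℝ (Fin 3), ⟪curl (v t) x, gradient (q t) x⟫_ℝ = 0) →
      (∀ t < 0, ∀ x : EuclideanSpace ℝ (Fin 3),
        ⟪curl (v t) x,
            gradient (fun y => timeDerivWithin (Set.Iio 0) q t y + ⟪v t y, gradient (q t) y⟫_ℝ) x⟫_ℝ
          = - ⟪(Δ (curl (v t))) x, gradient (q t) x⟫_ℝ) →
      (∀ t < 0, ∀ x : EuclideanSpace ℝ (Fin 3),
        ⟪curl (v t) x, timeDerivWithin (Set.Iio 0) v t x⟫_ℝ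
          + ⟪curl (v t) x, gradient (fun y => ‖v t y‖ ^ 2 / 2) x⟫_ℝ
          + ⟪curl (v t) x, curl (curl (v t)) x⟫_ℝ = 0) →
      (∀ t < 0, ∀ (γ : ℝ → EuclideanSpace ℝ (Fin 3)) (T : ℝ), 0 < T →
        (∀ s, HasDerivAt γ (curl (v t) (γ s)) s) → Function.Periodic γ T →
          ∫ s in (0 : ℝ)..T, ⟪(Δ (curl (v t))) (γ s), gradient (q t) (γ s)⟫_ℝ = 0) →
      (∃ a : EuclideanSpace ℝ (Fin 3), ∀ t < 0, ∀ x : EuclideanSpace ℝ (Fin 3),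
          ∃ μ : ℝ, curl (v t) x = μ • a) ∨
      (∃ a : EuclideanSpace ℝ (Fin 3), a ≠ 0 ∧ ∀ t < 0, ∀ (x : EuclideanSpace ℝ (Fin 3)) (δ : ℝ),
          ∃ μ : ℝ, v t (x + δ • a) - v t x = μ • a) ∨
      (∃ e c : EuclideanSpace ℝ (Fin 3), e ≠ 0 ∧ ∀ t < 0, ∀ x : EuclideanSpace ℝ (Fin 3),
          fderiv ℝ (v t) x (cross e (x - c)) = cross e (v t x) ∧ ⟪v t x, cross e (x - c)⟫_ℝ = 0) ∨
      (∃ a b c : EuclideanSpace ℝ (Fin 3), ⟪a, b⟫_ℝ ≠ 0 ∧ ∀ t < 0, ∀ x : EuclideanSpace ℝ (Fin 3),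
          cross (curl (v t) x) (cross a (x - c) + b) = 0 ∧ ⟪v t x, cross a (x - c) + b⟫_ℝ = 0) ∨
      (∃ e₁ e₂ : EuclideanSpace ℝ (Fin 3), cross e₁ e₂ ≠ 0 ∧ ∀ t < 0, ∀ x : EuclideanSpace ℝ (Fin 3),
          ⟪curl (v t) x, gradient (fun y => ⟪v t y, e₁⟫_ℝ) x⟫_ℝ = 0 ∧
          ⟪curl (v t) x, gradient (fun y => ⟪v t y, e₂⟫_ℝ) x⟫_ℝ = 0) := by
  sorry

/-! ## Composition -/

/-- The line closes the crux: the landed five-hull reduction with the shear hull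
`isobaricLinesLiouville_of_hull5s` (identity layer ⟹ hulls (A), (B′), (C)–(E) ⟹ their landed
Liouville leaves) applied to the bet. -/
theorem IsobaricLinesLiouville_of : IsobaricLinesLiouville :=
  isobaricLinesLiouville_of_hull5s stub_hullRigidity

end Summit.NavierStokesRegularity.NavierStokesRegularity.Cruxes.IsobaricLinesLiouville.Lines.Ideator2Sketch

end
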